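import Summits.CriticalPhenomena.PercolationContinuityZ3.Theorems.FK.RandomClusterFiniteEnergy
import Summits.CriticalPhenomena.PercolationContinuityZ3.Theorems.FK.RandomClusterOneEdgeConditional
import Literature.Probability.LatticeModels.RandomClusterFiniteVolumePressure
import HarnessLib

/-!
# One edge given a cylinder condition: `p/(p+q(1-p)) ≤ φ^B_{G,p,q}(J_e | ω ∩ T = π) ≤ p` (Grimmett 2006, (3.50)),
# cylinder bookkeeping for Grimmett's sequential coupling, and `E[|ω| 1_X] = Σ_f φ(J_f ∩ X)`

Claimed R42 (8)(c) in the cell INBOX at 2026-08-27T11:05:32Z by fkp-10a gen 349 under provision (ι) (no coordinator fk-4 seated after g251 closed l.8021 2026-08-27T10:12Z; the lane lead absorbs the registry word; silence = consent; a seated coordinator’s word would govern); lineage row FO-10a-g349 (self-suggested), package g349-steepness, label ST-C.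
Support file of the `fk-continuity` cell (lineage fkp-10a, `--supports stmt-CriticalPhenomena-4575`); builds on
p205010 (kernel theorem, internal audit signed; external expert review pending).  No definitions, no named facts,
no sorries; standard axioms.  UNCONDITIONAL finite-graph random-cluster theory (`q ≥ 1`).

Grimmett 2006, proof of Theorem (3.45), pp. 54–55, first ingredients.  For the finite-volume measure
`φ_p = φ^B_{G,p,q}` (any wired set `B`), an edge `e ∈ E(G)`, a set `T` of already-examined edges with `e ∉ T` and a
prescription `π ⊆ T` of their states, write `C_T(π) = {ν | ν ∩ T = π}` for the cylinder and `J_e = {e open}`.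
**(3.50)**: `p/(p+q(1-p)) ≤ φ_p(J_e | C_T(π)) ≤ p` — one-edge finite energy (Thm. (3.1), (3.4); the tree's
`rcMeasure_div_mul_real_preimage_insert_le`, `rcMeasure_real_preimage_erase_le`) given the cylinder.  Plus the set
identities `C_{T+e}(π+e) = J_e ∩ C_T(π)`, `C_{T+e}(π) = J_eᶜ ∩ C_T(π)` that drive the induction of
`SprinklingCouplingFK.lean`, positivity of cylinders, and Russo's bookkeeping identity `E[|ω| 1_X] = Σ_f φ(J_f ∩ X)`.

## Contents (namespace `Summit.CriticalPhenomena.PercolationContinuityZ3.Theorems.FK`)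

* `insert_inter_coe_eq_of_notMem`, `sdiff_singleton_inter_coe_eq_of_notMem`, `setOf_insert_mem_edgeOpen_inter_cyl`,
  `setOf_sdiff_mem_edgeClosed_inter_cyl`, `cyl_insert_insert_eq`, `cyl_insert_eq`;
* `rcMeasure_real_pos_of_coe_mem`, `rcMeasure_real_cyl_pos`;
* **`div_mul_real_cyl_le_real_edgeOpen_inter_cyl`**, **`real_edgeOpen_inter_cyl_le_mul_real_cyl`** ((3.50));
* `rcExpect_card_mul_ite_eq_sum`.

## References

* G. Grimmett, *The Random-Cluster Model*, Springer 2006: §3.5 proof of Thm. (3.45), (3.50), pp. 54–55; Thm. (3.1)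
  (3.3)–(3.4); proof of Thm. (4.63) (4.73)–(4.75). [Grimmett2006]
-/

noncomputable section

open scoped Classical
open MeasureTheory Finset

namespace Summit.CriticalPhenomena.PercolationContinuityZ3.Theorems

namespace FK

open Literature.Probability.LatticeModels Literature.Probability.Percolation

section FiniteGraph

variable {V : Type*} [Fintype V] [DecidableEq V] (G : SimpleGraph V) [DecidableRel G.Adj]

/-! ### Cylinders `C_T(π) = {ν | ν ∩ T = π}` -/

omit [Fintype V] [DecidableEq V] in
/-- Inserting an unexamined edge does not change the trace on the examined ones. [folklore] -/
theorem insert_inter_coe_eq_of_notMem {T : Finset (Sym2 V)} {e : Sym2 V} (heT : e ∉ T) (ν : BondConfig V) :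
    insert e ν ∩ (↑T : Set (Sym2 V)) = ν ∩ ↑T := by
  ext f
  simp only [Set.mem_inter_iff, Set.mem_insert_iff, Finset.mem_coe]
  constructor
  · rintro ⟨rfl | h, hf⟩
    · exact absurd hf heT
    · exact ⟨h, hf⟩
  · rintro ⟨h, hf⟩
    exact ⟨Or.inr h, hf⟩

omit [Fintype V] [DecidableEq V] in
/-- Deleting an unexamined edge does not change the trace on the examined ones. [folklore] -/
theorem sdiff_singleton_inter_coe_eq_of_notMem {T : Finset (Sym2 V)} {e : Sym2 V} (heT : e ∉ T)
    (ν : BondConfig V) : ν \ {e} ∩ (↑T : Set (Sym2 V)) = ν ∩ ↑T := by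
  ext f
  simp only [Set.mem_inter_iff, Set.mem_sdiff, Set.mem_singleton_iff, Finset.mem_coe]
  constructor
  · rintro ⟨⟨h, -⟩, hf⟩
    exact ⟨h, hf⟩
  · rintro ⟨h, hf⟩
    exact ⟨⟨h, fun h' => heT (h' ▸ hf)⟩, hf⟩

omit [Fintype V] [DecidableEq V] in
/-- `{ν | ν ∪ {e} ∈ J_e ∩ C_T(π)} = C_T(π)` for `e ∉ T`. [folklore] -/
theorem setOf_insert_mem_edgeOpen_inter_cyl {T π : Finset (Sym2 V)} {e : Sym2 V} (heT : e ∉ T) :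
    {ν : BondConfig V | insert e ν ∈ {μ : BondConfig V | e ∈ μ} ∩ {μ | μ ∩ ↑T = ↑π}} =
      {ν | ν ∩ ↑T = ↑π} := by
  ext ν
  simp only [Set.mem_setOf_eq, Set.mem_inter_iff, Set.mem_insert_iff, true_or, true_and,
    insert_inter_coe_eq_of_notMem heT]

omit [Fintype V] [DecidableEq V] in
/-- `{ν | ν ∖ {e} ∈ J_eᶜ ∩ C_T(π)} = C_T(π)` for `e ∉ T`. [folklore] -/
theorem setOf_sdiff_mem_edgeClosed_inter_cyl {T π : Finset (Sym2 V)} {e : Sym2 V} (heT : e ∉ T) :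
    {ν : BondConfig V | ν \ {e} ∈ {μ : BondConfig V | e ∉ μ} ∩ {μ | μ ∩ ↑T = ↑π}} =
      {ν | ν ∩ ↑T = ↑π} := by
  ext ν
  simp only [Set.mem_setOf_eq, Set.mem_inter_iff, Set.mem_sdiff, Set.mem_singleton_iff, not_true_eq_false,
    and_false, not_false_eq_true, true_and, sdiff_singleton_inter_coe_eq_of_notMem heT]

omit [Fintype V] in
/-- `C_{T ∪ {e}}(π ∪ {e}) = J_e ∩ C_T(π)` for `e ∉ T ⊇ π`. [folklore] -/
theorem cyl_insert_insert_eq {T π : Finset (Sym2 V)} {e : Sym2 V} (heT : e ∉ T) (hπ : π ⊆ T) :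
    {ν : BondConfig V | ν ∩ ↑(insert e T) = ↑(insert e π)} =
      {ν : BondConfig V | e ∈ ν} ∩ {ν | ν ∩ ↑T = ↑π} := by
  have heπ : e ∉ π := fun h => heT (hπ h)
  ext ν
  simp only [Set.mem_setOf_eq, Set.mem_inter_iff, Finset.coe_insert]
  constructor
  · intro h
    have he : e ∈ ν := by
      have : e ∈ ν ∩ insert e (↑T : Set (Sym2 V)) := by rw [h]; exact Set.mem_insert _ _
      exact this.1
    refine ⟨he, ?_⟩
    ext f
    simp only [Set.mem_inter_iff, Finset.mem_coe]
    constructor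
    · rintro ⟨hf, hfT⟩
      have : f ∈ ν ∩ insert e (↑T : Set (Sym2 V)) := ⟨hf, Set.mem_insert_of_mem _ hfT⟩
      rw [h] at this
      rcases this with rfl | h'
      · exact absurd hfT heT
      · exact h'
    · intro hf
      have : f ∈ insert e (↑π : Set (Sym2 V)) := Set.mem_insert_of_mem _ hf
      rw [← h] at this
      exact ⟨this.1, hπ hf⟩
  · rintro ⟨he, h⟩
    ext f
    simp only [Set.mem_inter_iff, Set.mem_insert_iff, Finset.mem_coe]
    constructor
    · rintro ⟨hf, rfl | hfT⟩
      · exact Or.inl rfl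
      · right
        have : f ∈ ν ∩ (↑T : Set (Sym2 V)) := ⟨hf, hfT⟩
        rw [h] at this
        exact this
    · rintro (rfl | hfπ)
      · exact ⟨he, Or.inl rfl⟩
      · have : f ∈ ν ∩ (↑T : Set (Sym2 V)) := by rw [h]; exact hfπ
        exact ⟨this.1, Or.inr this.2⟩

omit [Fintype V] in
/-- `C_{T ∪ {e}}(π) = J_eᶜ ∩ C_T(π)` for `e ∉ T ⊇ π`. [folklore] -/
theorem cyl_insert_eq {T π : Finset (Sym2 V)} {e : Sym2 V} (heT : e ∉ T) (hπ : π ⊆ T) :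
    {ν : BondConfig V | ν ∩ ↑(insert e T) = ↑π} = {ν : BondConfig V | e ∉ ν} ∩ {ν | ν ∩ ↑T = ↑π} := by
  have heπ : e ∉ π := fun h => heT (hπ h)
  ext ν
  simp only [Set.mem_setOf_eq, Set.mem_inter_iff, Finset.coe_insert]
  constructor
  · intro h
    have he : e ∉ ν := by
      intro he
      have : e ∈ ν ∩ insert e (↑T : Set (Sym2 V)) := ⟨he, Set.mem_insert _ _⟩
      rw [h] at this
      exact heπ this
    refine ⟨he, ?_⟩
    ext f
    simp only [Set.mem_inter_iff, Finset.mem_coe]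
    constructor
    · rintro ⟨hf, hfT⟩
      have : f ∈ ν ∩ insert e (↑T : Set (Sym2 V)) := ⟨hf, Set.mem_insert_of_mem _ hfT⟩
      rw [h] at this
      exact this
    · intro hf
      have : f ∈ (↑π : Set (Sym2 V)) := hf
      rw [← h] at this
      exact ⟨this.1, hπ hf⟩
  · rintro ⟨he, h⟩
    ext f
    simp only [Set.mem_inter_iff, Set.mem_insert_iff, Finset.mem_coe]
    constructor
    · rintro ⟨hf, rfl | hfT⟩
      · exact absurd hf he
      · have : f ∈ ν ∩ (↑T : Set (Sym2 V)) := ⟨hf, hfT⟩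
        rw [h] at this
        exact this
    · intro hfπ
      have : f ∈ ν ∩ (↑T : Set (Sym2 V)) := by rw [h]; exact hfπ
      exact ⟨this.1, Or.inr this.2⟩

/-- A set of configurations containing some edge set of `G` has positive `φ^B_{G,p,q}`-probability for
`p ∈ (0,1)`, `q > 0` (every edge set of `G` has positive weight). [cite: Grimmett2006, §1.2 eq. (1.2)] -/
theorem rcMeasure_real_pos_of_coe_mem {p q : ℝ} (hp : p ∈ Set.Ioo (0 : ℝ) 1) (hq : 0 < q) (B : Set V)
    {X : Set (BondConfig V)} {ω₀ : Finset (Sym2 V)} (hω₀ : ω₀ ⊆ G.edgeFinset)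
    (hX : (↑ω₀ : BondConfig V) ∈ X) : 0 < (rcMeasure G p q B).real X := by
  have hpI : p ∈ Set.Icc (0 : ℝ) 1 := ⟨hp.1.le, hp.2.le⟩
  have hZ := rcPartitionFunction_pos G hpI hq B
  rw [rcMeasure_real_apply G hpI hq B X]
  have hnn : ∀ ω ∈ G.edgeFinset.powerset,
      0 ≤ (if (↑ω : BondConfig V) ∈ X then rcWeight G p q B ω / rcPartitionFunction G p q B else 0) := by
    intro ω _
    split_ifs
    · exact div_nonneg (rcWeight_nonneg G hpI hq.le B ω) hZ.le
    · exact le_rfl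
  refine lt_of_lt_of_le ?_ (Finset.single_le_sum hnn (Finset.mem_powerset.2 hω₀))
  rw [if_pos hX]
  refine div_pos ?_ hZ
  unfold rcWeight
  exact mul_pos (mul_pos (pow_pos hp.1 _) (pow_pos (sub_pos.2 hp.2) _)) (pow_pos hq _)

/-- The cylinder `C_T(π)`, `π ⊆ T ⊆ E(G)`, has positive probability for `p ∈ (0,1)` (it contains the edge set `π`).
[cite: Grimmett2006, §1.2 eq. (1.2)] -/
theorem rcMeasure_real_cyl_pos {p q : ℝ} (hp : p ∈ Set.Ioo (0 : ℝ) 1) (hq : 0 < q) (B : Set V)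
    {T π : Finset (Sym2 V)} (hT : T ⊆ G.edgeFinset) (hπ : π ⊆ T) :
    0 < (rcMeasure G p q B).real {ν : BondConfig V | ν ∩ ↑T = ↑π} :=
  rcMeasure_real_pos_of_coe_mem G hp hq B (hπ.trans hT) (by
    show (↑π : Set (Sym2 V)) ∩ ↑T = ↑π
    rw [Set.inter_eq_left]; exact Finset.coe_subset.2 hπ)

/-! ### (3.50): one-edge finite energy given a cylinder -/

/-- **(3.50), lower bound**: `p/(p+q(1-p)) · φ(C_T(π)) ≤ φ(J_e ∩ C_T(π))` for `e ∈ E(G) ∖ T`, `q ≥ 1`.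
[cite: Grimmett2006, proof of Thm. (3.45), eq. (3.50)] -/
theorem div_mul_real_cyl_le_real_edgeOpen_inter_cyl {p q : ℝ} (hp : p ∈ Set.Icc (0 : ℝ) 1) (hq : 1 ≤ q)
    (B : Set V) {T π : Finset (Sym2 V)} {e : Sym2 V} (he : e ∈ G.edgeFinset) (heT : e ∉ T) :
    p / (p + q * (1 - p)) * (rcMeasure G p q B).real {ν : BondConfig V | ν ∩ ↑T = ↑π} ≤
      (rcMeasure G p q B).real ({ν : BondConfig V | e ∈ ν} ∩ {ν | ν ∩ ↑T = ↑π}) := by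
  have h := rcMeasure_div_mul_real_preimage_insert_le G hp hq B he
    ({ν : BondConfig V | e ∈ ν} ∩ {ν | ν ∩ ↑T = ↑π})
  rwa [setOf_insert_mem_edgeOpen_inter_cyl heT] at h

/-- **(3.50), upper bound**: `φ(J_e ∩ C_T(π)) ≤ p · φ(C_T(π))` for `e ∉ T`, `q ≥ 1`.
[cite: Grimmett2006, proof of Thm. (3.45), eq. (3.50)] -/
theorem real_edgeOpen_inter_cyl_le_mul_real_cyl {p q : ℝ} (hp : p ∈ Set.Icc (0 : ℝ) 1) (hq : 1 ≤ q)
    (B : Set V) {T π : Finset (Sym2 V)} {e : Sym2 V} (heT : e ∉ T) :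
    (rcMeasure G p q B).real ({ν : BondConfig V | e ∈ ν} ∩ {ν | ν ∩ ↑T = ↑π}) ≤
      p * (rcMeasure G p q B).real {ν : BondConfig V | ν ∩ ↑T = ↑π} := by
  have hq0 : 0 < q := one_pos.trans_le hq
  have h := rcMeasure_real_preimage_erase_le G hp hq B e ({ν : BondConfig V | e ∉ ν} ∩ {ν | ν ∩ ↑T = ↑π})
  rw [setOf_sdiff_mem_edgeClosed_inter_cyl heT] at h
  have hsplit := rcMeasure_real_eq_inter_edgeOpen_add G hp hq0 B e {ν : BondConfig V | ν ∩ ↑T = ↑π}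
  rw [Set.inter_comm _ {ν : BondConfig V | e ∈ ν}, Set.inter_comm _ {ν : BondConfig V | e ∉ ν}] at hsplit
  nlinarith [hsplit, h]

/-! ### Russo's formula for a conditional probability: `E[|ω| 1_X] = Σ_f φ(J_f ∩ X)` -/

/-- `E[|ω| 1_X] = Σ_{f ∈ E(G)} φ(J_f ∩ X)`. [cite: Grimmett2006, proof of Thm. (4.63), (4.73)–(4.75)] -/
theorem rcExpect_card_mul_ite_eq_sum {p q : ℝ} (hp : p ∈ Set.Icc (0 : ℝ) 1) (hq : 0 < q) (B : Set V)
    (X : Set (BondConfig V)) [DecidablePred (· ∈ X)] :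
    rcExpect G p q B (fun ω => (ω.card : ℝ) * if (↑ω : BondConfig V) ∈ X then 1 else 0) =
      ∑ f ∈ G.edgeFinset, (rcMeasure G p q B).real ({ν : BondConfig V | f ∈ ν} ∩ X) := by
  have hf : ∀ f ∈ G.edgeFinset, (rcMeasure G p q B).real ({ν : BondConfig V | f ∈ ν} ∩ X) =
      rcExpect G p q B (fun ω => if f ∈ ω then (if (↑ω : BondConfig V) ∈ X then (1 : ℝ) else 0) else 0) := by
    intro f _
    rw [rcMeasure_real_eq_rcExpect G hp hq B]
    refine rcExpect_congr G p q B fun ω _ => ?_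
    by_cases h1 : f ∈ ω <;> by_cases h2 : (↑ω : BondConfig V) ∈ X <;> simp [h1, h2]
  rw [Finset.sum_congr rfl hf, ← rcExpect_finset_sum]
  refine rcExpect_congr G p q B fun ω hω => ?_
  by_cases h2 : (↑ω : BondConfig V) ∈ X
  · simp only [h2, if_true, mul_one]
    rw [Finset.sum_boole, Finset.filter_mem_eq_inter, Finset.inter_eq_right.2 hω]
  · simp [h2]


end FiniteGraph

end FK

end Summit.CriticalPhenomena.PercolationContinuityZ3.Theorems

end
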